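import Summits.RiemannHypothesis.RiemannHypothesis.Theorems.SemilocalSoninBridgeOne
import Summits.RiemannHypothesis.RiemannHypothesis.Theorems.SemilocalPolyIncrement
import Summits.RiemannHypothesis.RiemannHypothesis.Theorems.SemilocalNegTerms
import Summits.RiemannHypothesis.RiemannHypothesis.Theorems.SoninCertData
import HarnessLib

/-!
# Polynomial windows as certificate test functions for the semilocal Sonin bridge (generic, any parity)

Cell `rh-explicit`, seat cc-s2-1 (HOME `run/shared/lean/pub/rh-explicit/`; lead rulings R7-12/R7-12a, PHASE 2 of the
Lean landing of `¬ SemilocalSoninIneqOn 2 a`, `a > 107/200`).  The certificate bridge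
`not_semilocalSoninIneqOn_two_of_bdd_witness_one` (`SemilocalSoninBridgeOne`) asks, of the test function `G`, for:
measurability, a bound `‖G‖ ≤ M`, vanishing off `[−b, b]`, a.e. continuity, CC's two moment conditions
`mulFourier G 0 = 0`, `mulFourier G (I/2) = 0`, and `‖T_2(G ⋆ G̃)‖₁ < K`.  This file discharges all of them for the
GENERIC polynomial window `G = polyWitness g b = g·1_{[−b,b]}` of seat cc-s2-4 (`g : List ℚ`, `b : ℚ`, ANY parity),
from hypotheses that are equalities / inequalities of rationals (each `decide`-able on concrete data):

* regularity: `measurable_polyWitness`, `norm_polyWitness_le` (`M = LQ.absBound g b`), `polyWitness_eq_zero_of_lt`,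
  `ae_continuousAt_polyWitness`, `integrable_polyWitness`;
* moments by the fundamental theorem of calculus: if `g = F″ + F′/2` as coefficient lists (`SoninCert.derivL`) and
  `F′(±b) = 0` then `mulFourier G (I/2) = ∫_{−b}^{b} g e^{t/2} = [F′e^{t/2}]_{−b}^{b} = 0`
  (`mulFourier_polyWitness_I_half_eq_zero`); if moreover `F(±b) = 0` then `mulFourier G 0 = [F′ + F/2]_{−b}^{b} = 0`
  (`mulFourier_polyWitness_zero_eq_zero`); the derivative of a list polynomial is `hasDerivAt_ev`;
* the `L¹` norm of the twisted kernel: Young `‖f ⋆ h‖₁ ≤ ‖f‖₁‖h‖₁` (`integral_norm_weilConv_le`), Cauchy–Schwarz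
  `‖G‖₁² ≤ 2b‖G‖₂²` for `G` vanishing off `[−b,b]` (`sq_integral_norm_le_of_bdd`), `1 + 2⁻¹ + 2e^{−log 2/2} = 3/2 + √2`,
  hence `‖T_2(G⋆G̃)‖₁ ≤ (3/2 + √2)·2b·‖G‖₂²` (`integral_norm_twistKernel_two_le_of_bdd`) and, for the polynomial
  window, `< K` as soon as `(3/2 + 1.41422)·2b·LQ.normSq g b < K` in `ℚ` (`integral_norm_twistKernel_polyWitness_lt`).

Proof-only file (no definitions, no named facts). [folklore]
-/

set_option linter.dupNamespace false  -- the mandated namespace repeats `RiemannHypothesis`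

noncomputable section

open MeasureTheory Complex Set Filter Topology Finset
open scoped Real ComplexConjugate Convolution ENNReal

namespace Summit.RiemannHypothesis.RiemannHypothesis

open Literature.NumberTheory.LFunctions Literature.NumberTheory.ConnesConsani2021
  Summit.RiemannHypothesis.RiemannHypothesis.Theorems.MotivicDoor.SemilocalMarkov
  Summit.RiemannHypothesis.RiemannHypothesis.Theorems.SemilocalPolyWitness
  Summit.RiemannHypothesis.RiemannHypothesis.Theorems.SemilocalPolyWitness.LQ

/-! ## `L¹` bounds for autocorrelation kernels of bounded windows -/

section General

variable {G : ℝ → ℂ} {b M : ℝ}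

/-- **Young's inequality, `L¹ × L¹ → L¹`** for the additive convolution: `∫‖f ⋆ h‖ ≤ (∫‖f‖)(∫‖h‖)`. [folklore] -/
theorem integral_norm_weilConv_le {f h : ℝ → ℂ} (hf : Integrable f) (hh : Integrable h) :
    ∫ t, ‖weilConv f h t‖ ≤ (∫ u, ‖f u‖) * ∫ u, ‖h u‖ := by
  have hF : Integrable (fun u ↦ ‖f u‖) := hf.norm
  have hH : Integrable (fun u ↦ ‖h u‖) := hh.norm
  have hpt : ∀ t, ‖weilConv f h t‖
      ≤ ((fun u ↦ ‖f u‖) ⋆[ContinuousLinearMap.mul ℝ ℝ, volume] (fun u ↦ ‖h u‖)) t := fun t ↦ by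
    rw [weilConv_apply, convolution_def]
    simp only [ContinuousLinearMap.mul_apply']
    calc ‖∫ u, f u * h (t - u)‖ ≤ ∫ u, ‖f u * h (t - u)‖ := norm_integral_le_integral_norm _
      _ = ∫ u, ‖f u‖ * ‖h (t - u)‖ := by simp_rw [norm_mul]
  have hconv : Integrable ((fun u ↦ ‖f u‖) ⋆[ContinuousLinearMap.mul ℝ ℝ, volume] (fun u ↦ ‖h u‖)) :=
    hF.integrable_convolution _ hH
  calc ∫ t, ‖weilConv f h t‖
      ≤ ∫ t, ((fun u ↦ ‖f u‖) ⋆[ContinuousLinearMap.mul ℝ ℝ, volume] (fun u ↦ ‖h u‖)) t :=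
        integral_mono_of_nonneg (Eventually.of_forall fun _ ↦ norm_nonneg _) hconv (Eventually.of_forall hpt)
    _ = (∫ u, ‖f u‖) * ∫ u, ‖h u‖ := by
        rw [integral_convolution (ContinuousLinearMap.mul ℝ ℝ) hF hH]; rfl

/-- `∫‖g̃‖ = ∫‖g‖` for the involution `g̃(t) = conj g(−t)`. [folklore] -/
theorem integral_norm_weilReflect (g : ℝ → ℂ) : ∫ u, ‖weilReflect g u‖ = ∫ u, ‖g u‖ := by
  have h := integral_norm_weilReflect_sub g 0
  have h0 : weilReflect (0 : ℝ → ℂ) = 0 := by funext t; simp [weilReflect]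
  simpa [h0] using h

/-- **Cauchy–Schwarz on the window**: if `G` is bounded, measurable and vanishes off `[−b, b]` (`0 < b`) then
`(∫‖G‖)² ≤ 2b · ∫‖G‖²` (from `0 ≤ ∫_{[−b,b]} (‖G‖ − λ)²` at `λ = ‖G‖₁/(2b)`). [folklore] -/
theorem sq_integral_norm_le_of_bdd (hGm : Measurable G) (hM : ∀ x, ‖G x‖ ≤ M) (hGb : ∀ x, b < |x| → G x = 0)
    (hb : 0 < b) : (∫ x, ‖G x‖) ^ 2 ≤ 2 * b * ∫ x, ‖G x‖ ^ 2 := by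
  set S : Set ℝ := Icc (-b) b with hS
  have hGi : Integrable G := integrable_of_bdd hGm hM hGb
  have hG2 : Integrable fun x ↦ ‖G x‖ ^ 2 := integrable_norm_sq_of_bdd hGm hM hGb
  have hout : ∀ x, x ∉ S → G x = 0 := fun x hx ↦ hGb x (lt_abs_of_not_mem_Icc hx)
  have hA : ∫ x, ‖G x‖ = ∫ x in S, ‖G x‖ :=
    (setIntegral_eq_integral_of_forall_compl_eq_zero fun x hx ↦ by rw [hout x hx, norm_zero]).symm
  have hN : ∫ x, ‖G x‖ ^ 2 = ∫ x in S, ‖G x‖ ^ 2 :=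
    (setIntegral_eq_integral_of_forall_compl_eq_zero fun x hx ↦ by
      rw [hout x hx, norm_zero]; ring).symm
  set A : ℝ := ∫ x, ‖G x‖ with hAdef
  set N : ℝ := ∫ x, ‖G x‖ ^ 2 with hNdef
  have hvol : volume.real S = 2 * b := by
    rw [measureReal_def, hS, Real.volume_Icc, ENNReal.toReal_ofReal (by linarith)]; ring
  have i1 : IntegrableOn (fun x ↦ ‖G x‖) S := hGi.norm.integrableOn
  have i2 : IntegrableOn (fun x ↦ ‖G x‖ ^ 2) S := hG2.integrableOn
  have i3 : IntegrableOn (fun _ ↦ (A / (2 * b)) ^ 2) S := by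
    rw [hS]; exact integrableOn_const (by rw [Real.volume_Icc]; exact ENNReal.ofReal_ne_top)
  have key : 0 ≤ ∫ x in S, (‖G x‖ - A / (2 * b)) ^ 2 :=
    setIntegral_nonneg measurableSet_Icc fun x _ ↦ sq_nonneg _
  have hexp : ∫ x in S, (‖G x‖ - A / (2 * b)) ^ 2
      = N - 2 * (A / (2 * b)) * A + (A / (2 * b)) ^ 2 * (2 * b) := by
    have e : ∀ x, (‖G x‖ - A / (2 * b)) ^ 2
        = (‖G x‖ ^ 2 - 2 * (A / (2 * b)) * ‖G x‖) + (A / (2 * b)) ^ 2 := fun x ↦ by ring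
    simp_rw [e]
    have i4 : IntegrableOn (fun x ↦ 2 * (A / (2 * b)) * ‖G x‖) S := i1.const_mul _
    have i5 : IntegrableOn (fun x ↦ ‖G x‖ ^ 2 - 2 * (A / (2 * b)) * ‖G x‖) S := i2.sub i4
    rw [integral_add i5 i3, integral_sub i2 i4, integral_const_mul,
      setIntegral_const, hvol, ← hA, ← hN, smul_eq_mul]
    ring
  rw [hexp] at key
  have hb2 : (0 : ℝ) < 2 * b := by linarith
  have e2 : N - 2 * (A / (2 * b)) * A + (A / (2 * b)) ^ 2 * (2 * b) = N - A ^ 2 / (2 * b) := by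
    field_simp; ring
  rw [e2] at key
  have : A ^ 2 / (2 * b) ≤ N := by linarith
  rwa [div_le_iff₀ hb2, mul_comm] at this

/-- `1 + 2⁻¹ + 2·e^{−log 2/2} = 3/2 + √2` (the `L¹` norm of the twisting measure at `p = 2`). [folklore] -/
theorem twistKernel_two_mass : 1 + (2 : ℝ)⁻¹ + 2 * Real.exp (-(Real.log 2 / 2)) = 3 / 2 + Real.sqrt 2 := by
  have h1 : Real.exp (Real.log 2 / 2) = Real.sqrt 2 := by
    rw [Real.exp_half, Real.exp_log two_pos]
  have h2 : Real.exp (-(Real.log 2 / 2)) = (Real.sqrt 2)⁻¹ := by rw [Real.exp_neg, h1]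
  have h3 : Real.sqrt 2 * Real.sqrt 2 = 2 := Real.mul_self_sqrt (by norm_num)
  have h4 : Real.sqrt 2 ≠ 0 := by positivity
  have h5 : 2 * (Real.sqrt 2)⁻¹ = Real.sqrt 2 := by
    field_simp
    linarith [h3]
  rw [h2, h5]; norm_num

/-- **`‖T_2(G ⋆ G̃)‖₁ ≤ (3/2 + √2) · 2b · ‖G‖₂²`** for a bounded measurable `G` vanishing off `[−b, b]`, `0 < b`
(twist mass `3/2 + √2`, Young, Cauchy–Schwarz). [folklore] -/
theorem integral_norm_twistKernel_two_le_of_bdd (hGm : Measurable G) (hM : ∀ x, ‖G x‖ ≤ M)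
    (hGb : ∀ x, b < |x| → G x = 0) (hb : 0 < b) :
    ∫ τ, ‖twistKernel 2 (weilConv G (weilReflect G)) τ‖ ≤ (3 / 2 + Real.sqrt 2) * (2 * b * ∫ x, ‖G x‖ ^ 2) := by
  have hGi : Integrable G := integrable_of_bdd hGm hM hGb
  have hRi : Integrable (weilReflect G) := Theorems.PfPersistence.integrable_weilReflect hGi
  have hk : Integrable (weilConv G (weilReflect G)) := hGi.integrable_convolution _ hRi
  have h1 := integral_norm_twistKernel_le 2 hk
  rw [show ((2 : ℕ) : ℝ) = 2 by norm_num, twistKernel_two_mass] at h1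
  refine h1.trans (mul_le_mul_of_nonneg_left ?_ (by positivity))
  calc ∫ τ, ‖weilConv G (weilReflect G) τ‖ ≤ (∫ u, ‖G u‖) * ∫ u, ‖weilReflect G u‖ :=
        integral_norm_weilConv_le hGi hRi
    _ = (∫ u, ‖G u‖) ^ 2 := by rw [integral_norm_weilReflect, sq]
    _ ≤ 2 * b * ∫ x, ‖G x‖ ^ 2 := sq_integral_norm_le_of_bdd hGm hM hGb hb

end General

end Summit.RiemannHypothesis.RiemannHypothesis

/-! ## The polynomial window `G = g·1_{[−b,b]}` (any parity) -/

namespace Summit.RiemannHypothesis.RiemannHypothesis.Theorems.SemilocalPolyWitness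

open Literature.NumberTheory.LFunctions Literature.NumberTheory.ConnesConsani2021
  Summit.RiemannHypothesis.RiemannHypothesis.Theorems.MotivicDoor.SemilocalMarkov LQ
  Summit.RiemannHypothesis.RiemannHypothesis.SoninCert

variable {p : List ℚ} {b : ℚ}

/-! ### Regularity -/

/-- `G` is measurable. [folklore] -/
theorem measurable_polyWitness : Measurable (polyWitness p b) :=
  Complex.measurable_ofReal.comp measurable_polyWitnessRe

/-- `‖G x‖ ≤ absBound g b`. [folklore] -/
theorem norm_polyWitness_le (hb : 0 < b) (x : ℝ) : ‖polyWitness p b x‖ ≤ (absBound p b : ℝ) := by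
  rw [norm_polyWitness]; exact abs_polyWitnessRe_le hb x

/-- `G x = 0` for `|x| > b`. [folklore] -/
theorem polyWitness_eq_zero_of_lt {x : ℝ} (hx : (b : ℝ) < |x|) : polyWitness p b x = 0 := by
  have : x ∉ Icc (-(b : ℝ)) b := fun h ↦ by
    rw [Set.mem_Icc] at h; exact (abs_le.2 h).not_gt hx
  simp [polyWitness, polyWitnessRe_of_not_mem this]

/-- `G` is integrable. [folklore] -/
theorem integrable_polyWitness (hb : 0 < b) : Integrable (polyWitness p b) :=
  integrable_of_bdd measurable_polyWitness (norm_polyWitness_le hb) fun _ hx ↦ polyWitness_eq_zero_of_lt hx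

/-- `G` is continuous at every point except possibly `±b` — in particular a.e. [folklore] -/
theorem ae_continuousAt_polyWitness : ∀ᵐ x : ℝ, ContinuousAt (polyWitness p b) x := by
  have h0 : volume ({-(b : ℝ), (b : ℝ)} : Set ℝ) = 0 :=
    (Set.toFinite ({-(b : ℝ), (b : ℝ)} : Set ℝ)).measure_zero volume
  refine (measure_eq_zero_iff_ae_notMem.1 h0).mono fun x hx ↦ ?_
  simp only [Set.mem_insert_iff, Set.mem_singleton_iff, not_or] at hx
  by_cases h : x ∈ Ioo (-(b : ℝ)) b
  · have hev : (fun y ↦ ((ev p y : ℝ) : ℂ)) =ᶠ[𝓝 x] polyWitness p b := by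
      filter_upwards [Ioo_mem_nhds h.1 h.2] with y hy
      simp [polyWitness, polyWitnessRe_of_mem (Ioo_subset_Icc_self hy)]
    exact ((Complex.continuous_ofReal.comp (continuous_ev p)).continuousAt).congr hev
  · have hout : x ∉ Icc (-(b : ℝ)) b := fun hm ↦
      h ⟨lt_of_le_of_ne hm.1 (Ne.symm hx.1), lt_of_le_of_ne hm.2 hx.2⟩
    have hev : (fun _ ↦ (0 : ℂ)) =ᶠ[𝓝 x] polyWitness p b := by
      filter_upwards [isClosed_Icc.isOpen_compl.mem_nhds hout] with y hy
      simp [polyWitness, polyWitnessRe_of_not_mem hy]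
    exact continuousAt_const.congr hev

/-! ### The `L¹` norm of the twisted kernel -/

/-- `‖T_2(G ⋆ G̃)‖₁ ≤ (3/2 + √2) · 2b · normSq g b`. [folklore] -/
theorem integral_norm_twistKernel_polyWitness_le (hb : 0 < b) :
    ∫ τ, ‖twistKernel 2 (weilConv (polyWitness p b) (weilReflect (polyWitness p b))) τ‖
      ≤ (3 / 2 + Real.sqrt 2) * (2 * b * LQ.normSq p b) := by
  rw [← integral_norm_sq_polyWitness hb]
  exact integral_norm_twistKernel_two_le_of_bdd measurable_polyWitness (norm_polyWitness_le hb)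
    (fun _ hx ↦ polyWitness_eq_zero_of_lt hx) (by exact_mod_cast hb)

/-- **`‖T_2(G ⋆ G̃)‖₁ < K`** as soon as `(3/2 + 1.41422) · 2b · normSq g b < K` holds in `ℚ`. [folklore] -/
theorem integral_norm_twistKernel_polyWitness_lt (hb : 0 < b) {K : ℚ}
    (hK : (3 / 2 + 141422 / 100000) * (2 * b) * LQ.normSq p b < K) :
    ∫ τ, ‖twistKernel 2 (weilConv (polyWitness p b) (weilReflect (polyWitness p b))) τ‖ < K := by
  refine (integral_norm_twistKernel_polyWitness_le hb).trans_lt ?_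
  have hN : (0 : ℝ) ≤ LQ.normSq p b := by
    rw [← integral_norm_sq_polyWitness hb]; exact integral_nonneg fun _ ↦ by positivity
  have hs : Real.sqrt 2 ≤ 141422 / 100000 := by
    rw [Real.sqrt_le_left (by norm_num)]; norm_num
  have hK' : ((((3 : ℚ) / 2 + 141422 / 100000) * (2 * b) * LQ.normSq p b : ℚ) : ℝ) < (K : ℝ) :=
    Rat.cast_lt.2 hK
  push_cast at hK'
  have hb' : (0 : ℝ) < b := by exact_mod_cast hb
  have h1 : (3 / 2 + Real.sqrt 2) * (2 * (b : ℝ) * (LQ.normSq p b : ℝ))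
      ≤ (3 / 2 + 141422 / 100000) * (2 * (b : ℝ) * (LQ.normSq p b : ℝ)) :=
    mul_le_mul_of_nonneg_right (by linarith) (by positivity)
  linarith

/-! ### The derivative of a list polynomial (`SoninCert.derivL`) -/

/-- Length of the formal derivative. [folklore] -/
theorem length_derivL (l : List ℚ) : (derivL l).length = l.length - 1 := by
  simp [derivL]

/-- Coefficients of the formal derivative. [folklore] -/
theorem getD_derivL (l : List ℚ) {k : ℕ} (hk : k < l.length - 1) :
    (derivL l).getD k 0 = ((k : ℚ) + 1) * l.getD (k + 1) 0 := by
  rw [derivL, List.getD_eq_getElem?_getD, List.getElem?_map, List.getElem?_range hk]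
  rfl

/-- Sum form of the derivative's evaluation. [folklore] -/
theorem ev_derivL_eq_sum (l : List ℚ) (x : ℝ) :
    ev (derivL l) x = ∑ k ∈ range (l.length - 1), (((k : ℚ) + 1) * l.getD (k + 1) 0 : ℚ) * x ^ k := by
  rw [ev_eq_sum, length_derivL]
  exact Finset.sum_congr rfl fun k hk ↦ by rw [getD_derivL l (Finset.mem_range.1 hk)]

/-- **The list derivative is the derivative**: `HasDerivAt (ev l) (ev (derivL l) x) x`. [folklore] -/
theorem hasDerivAt_ev (l : List ℚ) (x : ℝ) : HasDerivAt (ev l) (ev (derivL l) x) x := by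
  have e : ev l = fun y ↦ ∑ j ∈ range l.length, ((l.getD j 0 : ℚ) : ℝ) * y ^ j := by
    funext y; exact ev_eq_sum l y
  rw [e, ev_derivL_eq_sum]
  have hsum : HasDerivAt (fun y ↦ ∑ j ∈ range l.length, ((l.getD j 0 : ℚ) : ℝ) * y ^ j)
      (∑ j ∈ range l.length, ((l.getD j 0 : ℚ) : ℝ) * ((j : ℝ) * x ^ (j - 1))) x :=
    HasDerivAt.fun_sum fun j _ ↦ (hasDerivAt_pow j x).const_mul _
  convert hsum using 1
  rcases Nat.eq_zero_or_pos l.length with h0 | hpos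
  · simp [h0]
  · obtain ⟨m, hm⟩ : ∃ m, l.length = m + 1 := ⟨l.length - 1, by omega⟩
    rw [hm, Finset.sum_range_succ', Nat.add_sub_cancel]
    simp only [Nat.cast_zero, zero_mul, mul_zero, add_zero, Nat.add_sub_cancel, Nat.cast_succ]
    push_cast
    exact Finset.sum_congr rfl fun k _ ↦ by ring

/-- `ev l` is differentiable with continuous derivative `ev (derivL l)` (plumbing). [folklore] -/
theorem continuous_ev_derivL (l : List ℚ) : Continuous (ev (derivL l)) := continuous_ev _

/-! ### CC's two moment conditions for `g = F″ + F′/2` -/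

/-- `∫_u^v (F″ + F′/2) = [F′ + F/2]_u^v`. [folklore] -/
theorem intervalIntegral_ev_secondOrder (F : List ℚ) (u v : ℝ) :
    ∫ x in u..v, ev (add (derivL (derivL F)) (smul (1 / 2) (derivL F))) x
      = (ev (derivL F) v + ev F v / 2) - (ev (derivL F) u + ev F u / 2) := by
  have hd : ∀ x ∈ Set.uIcc u v, HasDerivAt (ev (derivL F) + fun y ↦ ev F y / 2)
      (ev (add (derivL (derivL F)) (smul (1 / 2) (derivL F))) x) x := fun x _ ↦ by
    refine ((hasDerivAt_ev (derivL F) x).add ((hasDerivAt_ev F x).div_const 2)).congr_deriv ?_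
    rw [ev_add, ev_smul]
    push_cast; ring
  have h := intervalIntegral.integral_eq_sub_of_hasDerivAt hd ((continuous_ev _).intervalIntegrable _ _)
  simpa only [Pi.add_apply] using h

/-- `∫_u^v (F″ + F′/2)(x) e^{x/2} dx = [F′(x) e^{x/2}]_u^v`. [folklore] -/
theorem intervalIntegral_ev_secondOrder_mul_exp_half (F : List ℚ) (u v : ℝ) :
    ∫ x in u..v, ev (add (derivL (derivL F)) (smul (1 / 2) (derivL F))) x * Real.exp (x / 2)
      = ev (derivL F) v * Real.exp (v / 2) - ev (derivL F) u * Real.exp (u / 2) := by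
  have hexp : ∀ x : ℝ, HasDerivAt (fun y : ℝ ↦ Real.exp (y / 2)) (Real.exp (x / 2) * (1 / 2)) x := fun x ↦
    ((hasDerivAt_id' x).div_const 2).exp
  have hd : ∀ x ∈ Set.uIcc u v, HasDerivAt (ev (derivL F) * fun y ↦ Real.exp (y / 2))
      (ev (add (derivL (derivL F)) (smul (1 / 2) (derivL F))) x * Real.exp (x / 2)) x := fun x _ ↦ by
    refine ((hasDerivAt_ev (derivL F) x).mul (hexp x)).congr_deriv ?_
    rw [ev_add, ev_smul]
    push_cast; ring
  have h := intervalIntegral.integral_eq_sub_of_hasDerivAt hd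
    (((continuous_ev _).mul (Real.continuous_exp.comp (continuous_id.div_const 2))).intervalIntegrable _ _)
  simpa only [Pi.mul_apply] using h

/-- `mulFourier G 0 = ∫_{−b}^{b} g` for the polynomial window. [folklore] -/
theorem mulFourier_polyWitness_zero (hb : 0 < b) :
    mulFourier (polyWitness p b) 0 = ((∫ x in (-(b : ℝ))..b, ev p x : ℝ) : ℂ) := by
  have hb' : (0 : ℝ) < b := by exact_mod_cast hb
  unfold mulFourier
  have e1 : (fun t : ℝ ↦ polyWitness p b t * cexp (-(I * 0 * (t : ℂ)))) = fun t ↦ ((polyWitnessRe p b t : ℝ) : ℂ) := by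
    funext t; simp [polyWitness]
  rw [e1, integral_complex_ofReal]
  congr 1
  rw [← setIntegral_eq_integral_of_forall_compl_eq_zero (s := Icc (-(b : ℝ)) b)
    (fun x hx ↦ by rw [polyWitnessRe_of_not_mem hx])]
  rw [setIntegral_congr_fun measurableSet_Icc
    (fun x hx ↦ by simp only [polyWitnessRe_of_mem hx] :
      EqOn (fun x ↦ polyWitnessRe p b x) (fun x ↦ ev p x) (Icc (-(b : ℝ)) b))]
  rw [integral_Icc_eq_integral_Ioc, ← intervalIntegral.integral_of_le (by linarith)]

/-- `mulFourier G (I/2) = ∫_{−b}^{b} g(x) e^{x/2} dx` for the polynomial window. [folklore] -/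
theorem mulFourier_polyWitness_I_half (hb : 0 < b) :
    mulFourier (polyWitness p b) (I / 2) = ((∫ x in (-(b : ℝ))..b, ev p x * Real.exp (x / 2) : ℝ) : ℂ) := by
  rw [mulFourier_I_half, weilMellin_polyWitness_one hb]

/-- **CC's condition `Ĝ(i/2) = 0`** for `G = (F″ + F′/2)·1_{[−b,b]}` with `F′(±b) = 0`. [folklore] -/
theorem mulFourier_polyWitness_I_half_eq_zero {F g : List ℚ} (hb : 0 < b)
    (hg : g = add (derivL (derivL F)) (smul (1 / 2) (derivL F)))
    (h1 : evQ (derivL F) b = 0) (h2 : evQ (derivL F) (-b) = 0) :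
    mulFourier (polyWitness g b) (I / 2) = 0 := by
  rw [mulFourier_polyWitness_I_half hb, hg, intervalIntegral_ev_secondOrder_mul_exp_half]
  rw [show (-(b : ℝ)) = ((-b : ℚ) : ℝ) by push_cast; ring, ev_ratCast, ev_ratCast, h1, h2]
  simp

/-- **CC's condition `Ĝ(0) = 0`** for `G = (F″ + F′/2)·1_{[−b,b]}` with `F(±b) = F′(±b) = 0`. [folklore] -/
theorem mulFourier_polyWitness_zero_eq_zero {F g : List ℚ} (hb : 0 < b)
    (hg : g = add (derivL (derivL F)) (smul (1 / 2) (derivL F)))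
    (h1 : evQ (derivL F) b = 0) (h2 : evQ (derivL F) (-b) = 0) (h3 : evQ F b = 0) (h4 : evQ F (-b) = 0) :
    mulFourier (polyWitness g b) 0 = 0 := by
  rw [mulFourier_polyWitness_zero hb, hg, intervalIntegral_ev_secondOrder]
  rw [show (-(b : ℝ)) = ((-b : ℚ) : ℝ) by push_cast; ring, ev_ratCast, ev_ratCast, ev_ratCast, ev_ratCast,
    h1, h2, h3, h4]
  simp

end Summit.RiemannHypothesis.RiemannHypothesis.Theorems.SemilocalPolyWitness

end
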